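import Mathlib

/-!
# Stub `stub_kernelData` for crux `MatrixDescartes`, line `Lift`

Kernel data at a positive root of a one-sided real symmetric pencil with positive semidefinite
lacunary part. For exponents `d k ≥ e`, a real symmetric constant matrix `J` and positive
semidefinite real matrices `P k`, consider the polynomial matrix
`X^e • J + ∑ₖ X^{d k} • P k` and the real matrix family `G(t) := J + ∑ₖ t^{d k - e} • P k`.
Evaluating the determinant at a real point `t` gives `t^(e·n) · det G(t)` (`eval_det_onesided`),
so at a positive root `t₀` of the determinant one has `det G(t₀) = 0`, whence a nonzero kernel
vector `v` of `G(t₀)`. For every `s > t₀` the quadratic form `v ⬝ᵥ (G(s) *ᵥ v)` equals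
`∑ₖ (s^{aₖ} - t₀^{aₖ}) · (v ⬝ᵥ (P k *ᵥ v)) ≥ 0` (`aₖ = d k - e`), and it is in fact `> 0`:
if it vanished, every summand would vanish, forcing `P k *ᵥ v = 0` whenever `aₖ ≠ 0`
(positive semidefinite kernel criterion `Matrix.PosSemidef.dotProduct_mulVec_zero_iff`), so that
`G(s') *ᵥ v = G(t₀) *ᵥ v = 0` for every real `s'`; then `det G(s') = 0` for all `s'` and the
determinant polynomial would vanish identically, contradicting the hypothesis that it is nonzero.
-/

set_option linter.dupNamespace false

namespace Summit.ValiantsHypothesis.ValiantsHypothesis.Theorems.LacunarySymmetroidMatrixDescartes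

open Polynomial Matrix Finset
open scoped BigOperators

/-- Entrywise evaluation of the one-sided pencil: at a real point `t` the polynomial matrix
`X^e • J.map C + ∑ₖ X^{d k} • (P k).map C` evaluates to `t^e • (J + ∑ₖ t^{d k - e} • P k)`,
provided `e ≤ d k` for all `k`. -/
theorem evalRingHom_mapMatrix_onesided {ι κ : Type*} [Fintype ι] [DecidableEq ι] [Fintype κ]
    (e : ℕ) (d : κ → ℕ) (J : Matrix ι ι ℝ) (P : κ → Matrix ι ι ℝ) (hd : ∀ k, e ≤ d k) (t : ℝ) :
    (Polynomial.evalRingHom t).mapMatrix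
        (((Polynomial.X : Polynomial ℝ) ^ e) • J.map Polynomial.C
          + ∑ k, ((Polynomial.X : Polynomial ℝ) ^ d k) • (P k).map Polynomial.C)
      = t ^ e • (J + ∑ k, (t ^ (d k - e)) • P k) := by
  ext i j
  simp only [RingHom.mapMatrix_apply, Matrix.map_apply, Matrix.add_apply, Matrix.smul_apply,
    Matrix.sum_apply, smul_eq_mul, Polynomial.coe_evalRingHom, Polynomial.eval_add,
    Polynomial.eval_mul, Polynomial.eval_pow, Polynomial.eval_X, Polynomial.eval_C,
    Polynomial.eval_finsetSum, mul_add, Finset.mul_sum]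
  congr 1
  refine Finset.sum_congr rfl fun k _ => ?_
  rw [← mul_assoc, ← pow_add, Nat.add_sub_cancel' (hd k)]

/-- Evaluating the determinant of the one-sided pencil `X^e • J + ∑ₖ X^{d k} • P k` at a real
point `t` gives `t^(e · card ι) · det (J + ∑ₖ t^{d k - e} • P k)` (`det` commutes with the
evaluation ring homomorphism, then `Matrix.det_smul`). -/
theorem eval_det_onesided {ι κ : Type*} [Fintype ι] [DecidableEq ι] [Fintype κ] (e : ℕ)
    (d : κ → ℕ) (J : Matrix ι ι ℝ) (P : κ → Matrix ι ι ℝ) (hd : ∀ k, e ≤ d k) (t : ℝ) :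
    (Matrix.det (((Polynomial.X : Polynomial ℝ) ^ e) • J.map Polynomial.C
        + ∑ k, ((Polynomial.X : Polynomial ℝ) ^ d k) • (P k).map Polynomial.C)).eval t
      = t ^ (e * Fintype.card ι) * (J + ∑ k, (t ^ (d k - e)) • P k).det := by
  -- adapted from `eval_det_pencil` in Theorems/SymmetroidDescartesRolleToDescartes.lean
  have h := RingHom.map_det (Polynomial.evalRingHom t)
    (((Polynomial.X : Polynomial ℝ) ^ e) • J.map Polynomial.C
      + ∑ k, ((Polynomial.X : Polynomial ℝ) ^ d k) • (P k).map Polynomial.C)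
  rw [Polynomial.coe_evalRingHom] at h
  rw [h, evalRingHom_mapMatrix_onesided e d J P hd t, Matrix.det_smul, pow_mul]

/-- The matrix family `G(s) = J + ∑ₖ s^{a k} • P k` applied to a vector. -/
theorem family_mulVec {ι κ : Type*} [Fintype ι] [Fintype κ] (a : κ → ℕ) (J : Matrix ι ι ℝ)
    (P : κ → Matrix ι ι ℝ) (v : ι → ℝ) (s : ℝ) :
    (J + ∑ k, (s ^ a k) • P k) *ᵥ v = J *ᵥ v + ∑ k, (s ^ a k) • (P k *ᵥ v) := by
  rw [Matrix.add_mulVec, Matrix.sum_mulVec]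
  simp only [Matrix.smul_mulVec]

/-- The quadratic form of the matrix family `G(s) = J + ∑ₖ s^{a k} • P k` at a vector `v`:
`v ⬝ᵥ (G(s) *ᵥ v) = v ⬝ᵥ (J *ᵥ v) + ∑ₖ s^{a k} · (v ⬝ᵥ (P k *ᵥ v))`. -/
theorem dotProduct_family_mulVec {ι κ : Type*} [Fintype ι] [Fintype κ] (a : κ → ℕ)
    (J : Matrix ι ι ℝ) (P : κ → Matrix ι ι ℝ) (v : ι → ℝ) (s : ℝ) :
    v ⬝ᵥ ((J + ∑ k, (s ^ a k) • P k) *ᵥ v)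
      = v ⬝ᵥ (J *ᵥ v) + ∑ k, s ^ a k * (v ⬝ᵥ (P k *ᵥ v)) := by
  rw [family_mulVec, dotProduct_add, dotProduct_sum]
  simp only [dotProduct_smul, smul_eq_mul]

/-- **Stub `stub_kernelData`.** For the one-sided pencil `X^e • J + ∑ₖ X^{d k} • P k`
(`J` real symmetric, `P k` positive semidefinite, `e ≤ d k`) with nonzero determinant and a
positive root `t₀` of the determinant, there is a nonzero kernel vector `v` of
`G(t₀) = J + ∑ₖ t₀^{d k - e} • P k` such that `v ⬝ᵥ (G(s) *ᵥ v) > 0` for every `s > t₀`. -/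
theorem stub_kernelData (ι κ : Type) [Fintype ι] [DecidableEq ι] [Fintype κ] (e : ℕ) (d : κ → ℕ)
    (J : Matrix ι ι ℝ) (P : κ → Matrix ι ι ℝ) (hJ : J.IsSymm) (hP : ∀ k, (P k).PosSemidef)
    (hd : ∀ k, e ≤ d k)
    (hdet : Matrix.det (((Polynomial.X : Polynomial ℝ) ^ e) • J.map Polynomial.C
        + ∑ k, ((Polynomial.X : Polynomial ℝ) ^ d k) • (P k).map Polynomial.C) ≠ 0)
    (t₀ : ℝ) (ht₀ : 0 < t₀)
    (hroot : (Matrix.det (((Polynomial.X : Polynomial ℝ) ^ e) • J.map Polynomial.C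
        + ∑ k, ((Polynomial.X : Polynomial ℝ) ^ d k) • (P k).map Polynomial.C)).IsRoot t₀) :
    ∃ v : ι → ℝ, v ≠ 0 ∧ (J + ∑ k, (t₀ ^ (d k - e)) • P k) *ᵥ v = 0 ∧
      ∀ s : ℝ, t₀ < s → 0 < v ⬝ᵥ ((J + ∑ k, (s ^ (d k - e)) • P k) *ᵥ v) := by
  -- (the symmetry hypothesis `hJ` is part of the registered signature but is not needed here)
  have _ := hJ
  -- Step 1: `det G(t₀) = 0`, from `p.eval t₀ = t₀^(e·n) · det G(t₀)` and `t₀ ≠ 0`.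
  have hdet0 : (J + ∑ k, (t₀ ^ (d k - e)) • P k).det = 0 := by
    have h1 : (Matrix.det (((Polynomial.X : Polynomial ℝ) ^ e) • J.map Polynomial.C
        + ∑ k, ((Polynomial.X : Polynomial ℝ) ^ d k) • (P k).map Polynomial.C)).eval t₀ = 0 :=
      hroot
    rw [eval_det_onesided e d J P hd t₀] at h1
    exact (mul_eq_zero.1 h1).resolve_left (pow_ne_zero _ ht₀.ne')
  -- Step 2: a nonzero kernel vector of `G(t₀)`.
  obtain ⟨v, hv, hGv⟩ := Matrix.exists_mulVec_eq_zero_iff.2 hdet0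
  refine ⟨v, hv, hGv, fun s hs => ?_⟩
  -- Step 3: the quadratic form at `s > t₀` is a sum of nonnegative terms.
  have hq : ∀ k, 0 ≤ v ⬝ᵥ (P k *ᵥ v) := fun k => by
    simpa only [star_trivial] using (hP k).dotProduct_mulVec_nonneg v
  have hquad0 : v ⬝ᵥ (J *ᵥ v) + ∑ k, t₀ ^ (d k - e) * (v ⬝ᵥ (P k *ᵥ v)) = 0 := by
    rw [← dotProduct_family_mulVec (fun k => d k - e) J P v t₀, hGv, dotProduct_zero]
  have hquad : v ⬝ᵥ ((J + ∑ k, (s ^ (d k - e)) • P k) *ᵥ v)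
      = ∑ k, (s ^ (d k - e) - t₀ ^ (d k - e)) * (v ⬝ᵥ (P k *ᵥ v)) := by
    rw [dotProduct_family_mulVec (fun k => d k - e) J P v s,
      eq_neg_of_add_eq_zero_left hquad0]
    simp only [sub_mul, Finset.sum_sub_distrib]
    ring
  have hterm : ∀ k, 0 ≤ (s ^ (d k - e) - t₀ ^ (d k - e)) * (v ⬝ᵥ (P k *ᵥ v)) := fun k =>
    mul_nonneg (sub_nonneg.2 (pow_le_pow_left₀ ht₀.le hs.le _)) (hq k)
  have hnonneg : 0 ≤ v ⬝ᵥ ((J + ∑ k, (s ^ (d k - e)) • P k) *ᵥ v) := by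
    rw [hquad]
    exact Finset.sum_nonneg fun k _ => hterm k
  refine hnonneg.lt_of_ne fun hzero => ?_
  -- Step 4: if the quadratic form vanished at `s`, every summand vanishes ...
  rw [hquad, eq_comm, Finset.sum_eq_zero_iff_of_nonneg (fun k _ => hterm k)] at hzero
  -- ... so each term `s'^{a k} • P k *ᵥ v` is independent of `s'` ...
  have hk : ∀ (k : κ) (s' : ℝ),
      (s' ^ (d k - e)) • (P k *ᵥ v) = (t₀ ^ (d k - e)) • (P k *ᵥ v) := by
    intro k s'
    rcases Nat.eq_zero_or_pos (d k - e) with h0 | hpos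
    · rw [h0, pow_zero, pow_zero]
    · have hlt : t₀ ^ (d k - e) < s ^ (d k - e) := pow_lt_pow_left₀ hs ht₀.le hpos.ne'
      have hqk : v ⬝ᵥ (P k *ᵥ v) = 0 :=
        (mul_eq_zero.1 (hzero k (Finset.mem_univ k))).resolve_left (sub_pos.2 hlt).ne'
      have hPv : P k *ᵥ v = 0 := by
        have h := (hP k).dotProduct_mulVec_zero_iff v
        rw [star_trivial] at h
        exact h.1 hqk
      rw [hPv, smul_zero, smul_zero]
  -- ... hence `G(s') *ᵥ v = G(t₀) *ᵥ v = 0` for every real `s'` ...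
  have hGs' : ∀ s' : ℝ, (J + ∑ k, (s' ^ (d k - e)) • P k) *ᵥ v = 0 := by
    intro s'
    rw [← hGv, family_mulVec (fun k => d k - e) J P v s',
      family_mulVec (fun k => d k - e) J P v t₀]
    congr 1
    exact Finset.sum_congr rfl fun k _ => hk k s'
  -- ... so `det G(s') = 0` for every `s'`, and the determinant polynomial vanishes identically.
  have hdet' : ∀ s' : ℝ, (J + ∑ k, (s' ^ (d k - e)) • P k).det = 0 := fun s' =>
    Matrix.exists_mulVec_eq_zero_iff.1 ⟨v, hv, hGs' s'⟩
  refine hdet (Polynomial.funext fun s' => ?_)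
  rw [eval_det_onesided e d J P hd s', hdet' s', mul_zero, Polynomial.eval_zero]

end Summit.ValiantsHypothesis.ValiantsHypothesis.Theorems.LacunarySymmetroidMatrixDescartes
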